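import Summits.QuantumFields.Balaban3D.Carriers.Series
import Summits.QuantumFields.Balaban3D.Proofs.TowerAC

/-!
# `Summit.QuantumFields.Balaban3D.Proofs.SeriesAC` — THE AC TOWER OF A SERIES: seat p1's `Carriers.StepSeries.TowerBase` /
# `Carriers.Series` (the interaction sum `Pint` and the vacuum energies `E^{(k)}` DEFINED from the expansion data, the R-RN barriers DEFINED as the
# printed step bounds (55)·(58) / p. 272 L32–33, the step pieces, LQB's leaves `PintSucc`/`Estep62`/`NoInteraction0` by `rfl`) twinned over the
# UNCAPPED masses of `…Proofs.TowerAC` — lane `pub-balaban3d`, seat alpha-1 (definition request `defn-AlphaInputsT3AC` of route `UnitScaleTilt`)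

Field for field the definitions of `Carriers.Series` with `TowerBase`/`TowerInput` replaced by `TowerBaseAC`/`TowerInputAC` (masses
`HistWeightsAC`, no `≤ 1`): `TowerBaseAC`, `preInputAC` (zero barriers, to read off the barrier-independent `LF`/`mainT`/`E_k`/`Zterm`/`Rm`/`χ`),
`exp55AC`/`upperOfAC`/`lowerOfAC` (the printed step bounds as barriers, v1.2 of seat p1), `withSeriesAC : TowerInputAC`, `seriesPiecesAC`, and the
`rfl` leaves.  The expansion data `Carriers.StepSeries`, `pintOfSeries`, `estepOfSeries`, `StepSeries.toStepData`, `PiecesParams` are seat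
p1's, reused BY NAME.  [folklore] bookkeeping; nothing of [Balaban1985UV3] is asserted.
-/

open MeasureTheory Finset
open scoped Matrix

namespace Summit.QuantumFields.Balaban3D.Proofs.SeriesAC

open Literature.MathematicalPhysics.QuantumFieldTheory.Balaban1983to89
open Literature.MathematicalPhysics.QuantumFieldTheory.Balaban1983to89.TreeLengthTorus (tsys TPt)
open Literature.MathematicalPhysics.QuantumFieldTheory.Balaban1985CMP102
open Literature.MathematicalPhysics.QuantumFieldTheory.Balaban1985CMP102.Setting
open Summit.QuantumFields.Balaban3D.Carriers
open Summit.QuantumFields.Balaban3D.Proofs.TowerAC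

variable {L : ℕ} {S : Scales L} {G : Type} [GaugeGroup G] [MeasurableSpace G] [HaarData G]

/-- THE AC TOWER INPUT WITHOUT ITS EXPANSION SUMS AND BARRIERS — seat p1's `Carriers.TowerBase` with `W : HistWeightsAC` (uncapped masses);
plus the retained-radius profile `Rret` (R-OMEGA). [folklore] -/
structure TowerBaseAC {L : ℕ} (S : Scales L) (G : Type) [GaugeGroup G] [MeasurableSpace G] [HaarData G] where
  /-- see `TowerInputAC` -/
  ε₁ : ℕ → ℝ
  /-- see `TowerInputAC` -/
  av : ∀ j, Averaging S.P j G
  /-- see `TowerInputAC` -/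
  avgAC : ∀ j, AvgAC (av j).avg
  /-- see `TowerInputAC` -/
  reg : ℕ → Set (GaugeField S.P 0 G)
  /-- see `TowerInputAC` -/
  Uk : (k : ℕ) → GaugeField S.P (k + 1) G → GaugeField S.P 0 G
  /-- see `TowerInputAC` -/
  M₁ : ℕ
  /-- see `TowerInputAC` -/
  Rcol : ℕ → ℕ
  /-- the retained-radius profile of (59) (R-OMEGA) -/
  Rret : ℕ → ℝ
  /-- see `TowerInputAC` -/
  b₀ : ℝ
  /-- see `TowerInputAC` -/
  p₀ : ℝ
  /-- see `TowerInputAC` -/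
  κ₀ : ℝ
  /-- the UNCAPPED masses -/
  W : HistWeightsAC S.P G
  /-- see `TowerInputAC` -/
  UkH : (k : ℕ) → Hist S.P k → GaugeField S.P k G → GaugeField S.P 0 G
  /-- see `TowerInputAC` -/
  UkH_triv : ∀ (k : ℕ) (V : GaugeField S.P k G), UkH k (Hist.triv S.P k) V = ukAll Uk k V
  /-- see `TowerInputAC` -/
  zcoef : ℕ → ℝ
  /-- see `TowerInputAC` -/
  rcoef : ℕ → ℝ

namespace TowerBaseAC

variable {V : Type} [NormedAddCommGroup V] [NormedSpace ℂ V] {Nc : ℕ → ℕ} [∀ k, NeZero (Nc k)]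
  (B : TowerBaseAC S G) (𝔖 : ∀ k, StepSeries S G V (Nc k) k) (C : ∀ k, PiecesParams S k)

/-- The PRE-TOWER input of a series: ZERO barriers — only used to read off the (barrier-independent) functional `LF`, main term, `E_k`,
`Z`-terms, remainders and `χ` of the series' tower. [folklore] -/
noncomputable def preInputAC : TowerInputAC S G where
  ε₁ := B.ε₁
  av := B.av
  avgAC := B.avgAC
  reg := B.reg
  Uk := B.Uk
  lower := fun _ _ => 0
  upper := fun _ _ => 0
  lower_nonneg := fun _ _ => le_rfl
  upper_nonneg := fun _ _ => le_rfl
  M₁ := B.M₁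
  Rcol := B.Rcol
  b₀ := B.b₀
  p₀ := B.p₀
  κ₀ := B.κ₀
  W := B.W
  UkH := B.UkH
  UkH_triv := B.UkH_triv
  Pint := pintOfSeries B.M₁ B.Rcol 𝔖
  zcoef := B.zcoef
  rcoef := B.rcoef
  Estep := estepOfSeries 𝔖 C

/-- THE EXPONENT OF THE UPPER STEP BOUND (55)·(58) pp. 269–270 at history `h'` and field `V` on `T^{(k+1)}`, in the term order of LQB's
`B10SectAGathering.Bound55`. [cite: Balaban1985UV3, (55) p.269 + (58) p.270] -/
noncomputable def exp55AC (k : ℕ) (U : GaugeField S.P (k + 1) G) (h' : Hist S.P (k + 1)) : ℝ :=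
  -(((B.preInputAC 𝔖 C).towerWith fun _ => True).mainT (k + 1) h' U) - ((B.preInputAC 𝔖 C).towerWith fun _ => True).Ecst k
    + ((C k).logσ₀ + (C k).dg * Real.log (S.gk k)) * (C k).starB h'
    + (𝔖 k).logZU h' U + (𝔖 k).Pold B.M₁ B.Rcol h' U
    + ((B.preInputAC 𝔖 C).towerWith fun _ => True).Zterm k (Hist.proj h') + ((B.preInputAC 𝔖 C).towerWith fun _ => True).Rm k
    + (𝔖 k).logFl h' U

/-- **THE UPPER BARRIER := the right-hand side of the printed upper step bound (55)·(58)**: `LF_{k+1}(V)[exp55AC]` (over the uncapped masses).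
[cite: Balaban1985UV3, (55) p.269 + (58) p.270] -/
noncomputable def upperOfAC (k : ℕ) (U : GaugeField S.P (k + 1) G) : ℝ :=
  ((B.preInputAC 𝔖 C).towerWith fun _ => True).LF (k + 1) U (B.exp55AC 𝔖 C k U)

/-- **THE LOWER BARRIER := the printed lower step bound at the trivial history** (p. 272 L32–33; LQB `Bound55Lower`), in the term order of seat
p4's `bound55Lower_of_select`. [cite: Balaban1985UV3, p.272 L32–33 + (47) p.267] -/
noncomputable def lowerOfAC (k : ℕ) (U : GaugeField S.P (k + 1) G) : ℝ :=
  ((B.preInputAC 𝔖 C).towerWith fun _ => True).chi (k + 1) U *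
    Real.exp (-(((B.preInputAC 𝔖 C).towerWith fun _ => True).mainT (k + 1) (Hist.triv S.P (k + 1)) U)
      - ((B.preInputAC 𝔖 C).towerWith fun _ => True).Ecst k
      + ((C k).logσ₀ + (C k).dg * Real.log (S.gk k)) * (C k).starB (Hist.triv S.P (k + 1))
      + (𝔖 k).logZU (Hist.triv S.P (k + 1)) U + (𝔖 k).Pold B.M₁ B.Rcol (Hist.triv S.P (k + 1)) U
      - ((B.preInputAC 𝔖 C).towerWith fun _ => True).Rm k + (𝔖 k).logFl (Hist.triv S.P (k + 1)) U)

/-- The lower barrier is non-negative (`χ ∈ {0, 1}` times an exponential). [folklore] -/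
theorem lowerOfAC_nonneg (k : ℕ) (U : GaugeField S.P (k + 1) G) : 0 ≤ B.lowerOfAC 𝔖 C k U := by
  refine mul_nonneg ?_ (Real.exp_pos _).le
  show 0 ≤ chiSmall _ _ _
  unfold chiSmall
  split_ifs <;> norm_num

/-- The upper barrier is non-negative (a value of the positive functional `LFAC`). [folklore] -/
theorem upperOfAC_nonneg (k : ℕ) (U : GaugeField S.P (k + 1) G) : 0 ≤ B.upperOfAC 𝔖 C k U :=
  lfAC_nonneg B.W (k + 1) U _

/-- THE AC TOWER INPUT OF A SERIES: `Pint` and `Estep` DEFINED from the expansion data (R-FL), the barriers DEFINED as the printed step bounds.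
[cite: Balaban1985UV3, (43) p.266 + (55) p.269 + (62) p.271] -/
noncomputable def withSeriesAC : TowerInputAC S G where
  ε₁ := B.ε₁
  av := B.av
  avgAC := B.avgAC
  reg := B.reg
  Uk := B.Uk
  lower := B.lowerOfAC 𝔖 C
  upper := B.upperOfAC 𝔖 C
  lower_nonneg := B.lowerOfAC_nonneg 𝔖 C
  upper_nonneg := B.upperOfAC_nonneg 𝔖 C
  M₁ := B.M₁
  Rcol := B.Rcol
  b₀ := B.b₀
  p₀ := B.p₀
  κ₀ := B.κ₀
  W := B.W
  UkH := B.UkH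
  UkH_triv := B.UkH_triv
  Pint := pintOfSeries B.M₁ B.Rcol 𝔖
  zcoef := B.zcoef
  rcoef := B.rcoef
  Estep := estepOfSeries 𝔖 C

/-! ## The step pieces of the series' AC tower and the `rfl` leaves -/

/-- THE STEP PIECES of the series' AC tower: `pieces3` at the DEFINED `StepData` of the series. [cite: Balaban1985UV3, (55)–(63) pp.269–272] -/
noncomputable def seriesPiecesAC (k : ℕ) : B10SectAGathering.StepPieces (B.withSeriesAC 𝔖 C).tower3.toTowerRun k :=
  (B.withSeriesAC 𝔖 C).pieces3 k ((𝔖 k).toStepData B.M₁ B.Rcol (B.Rret k)) (C k)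

/-- **LQB leaf `PintSucc` BY `rfl`** for the series' AC tower. [cite: Balaban1985UV3, (36) p.265 + (41) p.266] -/
theorem pintSucc_seriesAC (k : ℕ) : B10SectAGathering.PintSucc (B.seriesPiecesAC 𝔖 C k) := fun _ _ => rfl

/-- **LQB leaf `Estep62` BY `rfl`** for the series' AC tower (R-E). [cite: Balaban1985UV3, (62) p.271] -/
theorem estep62_seriesAC (k : ℕ) : B10SectAGathering.Estep62 (B.seriesPiecesAC 𝔖 C k) := rfl

/-- **No interaction at `k = 0`** (`Pint 0 = 0`): LQB `B10LargeField.NoInteraction0` BY `rfl` for the series' AC tower. [cite: Balaban1985UV3, (1) p.256] -/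
theorem noInteraction0_seriesAC : B10LargeField.NoInteraction0 (B.withSeriesAC 𝔖 C).tower3.toTowerRun := fun _ _ => rfl

/-- `Pint (k+1) = PoldIn_k + PY_k + PYZ_k` unfolded (R-FL (ii) / R-44). [cite: Balaban1985UV3, (43) p.266] -/
theorem withSeriesAC_Pint_succ (k : ℕ) (h : Hist S.P (k + 1)) (U : GaugeField S.P (k + 1) G) :
    (B.withSeriesAC 𝔖 C).Pint (k + 1) h U = (𝔖 k).PoldIn B.M₁ B.Rcol h U + (𝔖 k).PY h U + (𝔖 k).PYZ h U := rfl

/-- The interaction sum of `ρ₀` is `0` ((1): no interaction). [folklore] -/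
theorem withSeriesAC_Pint_zero (h : Hist S.P 0) (U : GaugeField S.P 0 G) : (B.withSeriesAC 𝔖 C).Pint 0 h U = 0 := rfl

/-- The OLD-TERM SUM of the series' pieces IS the (43) sum over the concrete index geometry (seat p5's `hPold` shape, `rfl`). [cite: Balaban1985UV3, (43) p.266 + (58) p.270] -/
theorem seriesPiecesAC_Pold (k : ℕ) (h : Hist S.P (k + 1)) (U : GaugeField S.P (k + 1) G) :
    (B.seriesPiecesAC 𝔖 C k).Pold h U =
      ∑ j ∈ Icc 1 k, ∑ y ∈ oldBlocks B.M₁ B.Rcol h j, ∑ n ∈ range ((𝔖 k).Ndeg j + 1),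
        ∑ c ∈ Fintype.piFinset (fun _ : Fin n => oldBonds B.M₁ B.Rcol h j y), (𝔖 k).oldVal h U j y n c := rfl

/-- The RETAINED old-term sum IS the same (43) sum with the dropped terms replaced by `0` (seat p5's `hPoldIn` shape, `rfl`). [cite: Balaban1985UV3, p.272 L29–31] -/
theorem seriesPiecesAC_PoldIn (k : ℕ) (h : Hist S.P (k + 1)) (U : GaugeField S.P (k + 1) G) :
    (B.seriesPiecesAC 𝔖 C k).PoldIn h U =
      ∑ j ∈ Icc 1 k, ∑ y ∈ oldBlocks B.M₁ B.Rcol h j, ∑ n ∈ range ((𝔖 k).Ndeg j + 1),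
        ∑ c ∈ Fintype.piFinset (fun _ : Fin n => oldBonds B.M₁ B.Rcol h j y),
          (if Drop B.M₁ B.Rcol h j y n c then 0 else (𝔖 k).oldVal h U j y n c) := rfl

/-- The RETAINED chart sum IS the (59) sum over the DEFINED blocks and radius (seat p5's `hPprU` shape, `rfl`). [cite: Balaban1985UV3, (59) p.270] -/
theorem seriesPiecesAC_PprU (k : ℕ) (h : Hist S.P (k + 1)) (U : GaugeField S.P (k + 1) G) :
    (B.seriesPiecesAC 𝔖 C k).PprU h U =
      ∑ X ∈ Finset.univ.filter (fun X : (tsys 3 (Nc k)).Dom => X.1 ⊆ ΩblkOf B.M₁ B.Rcol (Nc k) h ∧ (tsys 3 (Nc k)).dj X < B.Rret k),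
        (𝔖 k).act h X U := rfl

/-- **The `hZ` input of C3/C4/C6 for every series AC tower, a THEOREM**: `#(blocks ∖ Ω_{k+1}(h)) ≤ |Z_k(h)|` at the pieces' `Zvol` (seat p1's
`card_compl_ΩblkOf_le_ZVol`). [cite: Balaban1985UV3, p.270 L31] -/
theorem seriesPiecesAC_hZ (k : ℕ) (h : Hist S.P (k + 1)) :
    (((Finset.univ : Finset (TPt 3 (Nc k))) \ ΩblkOf B.M₁ B.Rcol (Nc k) h).card : ℝ) ≤ (B.seriesPiecesAC 𝔖 C k).Zvol h := by
  show (_ : ℝ) ≤ ((ZVol B.M₁ B.Rcol (k + 1) h k : ℕ) : ℝ)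
  exact_mod_cast card_compl_ΩblkOf_le_ZVol B.M₁ B.Rcol (Nc k) h

/-- **Seat p4's `hupper` BY `rfl`, for every series AC tower**: the upper barrier IS the right-hand side of (55)·(58) for THAT tower (any slot).
[cite: Balaban1985UV3, (55) p.269 + (58) p.270] -/
theorem withSeriesAC_upper (slot : ℕ → Prop) (k : ℕ) (U : GaugeField S.P (k + 1) G) :
    (B.withSeriesAC 𝔖 C).upper k U =
      ((B.withSeriesAC 𝔖 C).towerWith slot).LF (k + 1) U (fun h' =>
        -(((B.withSeriesAC 𝔖 C).towerWith slot).mainT (k + 1) h' U) - ((B.withSeriesAC 𝔖 C).towerWith slot).Ecst k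
        + ((C k).logσ₀ + (C k).dg * Real.log (S.gk k)) * (C k).starB h'
        + (𝔖 k).logZU h' U + (𝔖 k).Pold B.M₁ B.Rcol h' U
        + ((B.withSeriesAC 𝔖 C).towerWith slot).Zterm k (Hist.proj h') + ((B.withSeriesAC 𝔖 C).towerWith slot).Rm k
        + (𝔖 k).logFl h' U) := rfl

/-- **Seat p4's `hlower` BY `rfl`, for every series AC tower**: the lower barrier IS the printed lower step bound at the trivial history for
THAT tower (any slot). [cite: Balaban1985UV3, p.272 L32–33 + (47) p.267] -/
theorem withSeriesAC_lower (slot : ℕ → Prop) (k : ℕ) (U : GaugeField S.P (k + 1) G) :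
    (B.withSeriesAC 𝔖 C).lower k U =
      ((B.withSeriesAC 𝔖 C).towerWith slot).chi (k + 1) U *
        Real.exp (-(((B.withSeriesAC 𝔖 C).towerWith slot).mainT (k + 1) (Hist.triv S.P (k + 1)) U)
          - ((B.withSeriesAC 𝔖 C).towerWith slot).Ecst k
          + ((C k).logσ₀ + (C k).dg * Real.log (S.gk k)) * (C k).starB (Hist.triv S.P (k + 1))
          + (𝔖 k).logZU (Hist.triv S.P (k + 1)) U + (𝔖 k).Pold B.M₁ B.Rcol (Hist.triv S.P (k + 1)) U
          - ((B.withSeriesAC 𝔖 C).towerWith slot).Rm k + (𝔖 k).logFl (Hist.triv S.P (k + 1)) U) := rfl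

end TowerBaseAC

end Summit.QuantumFields.Balaban3D.Proofs.SeriesAC
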